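import Summits.HodgeConjecture.CorCM.HypDel.MumfordModuliReceptacle
import Summits.HodgeConjecture.HodgeConjecture.Theorems.MumfordRouteXiAssembly
import Summits.HodgeConjecture.HodgeConjecture.Theorems.HCCMUnconditionalHDelOfTwoFacts
import HarnessLib

/-!
# `hDel` from Mumford's moduli model ALONE (director g6 RULING s90 (B2); lead file of the #60 road, A-p05 g7)

After #61 `siegel_borel_extension` became a theorem (★ `HDel_of_S1`), the crux `HDel` of route
`HCCMUnconditional` (stmt-HodgeConjecture-24835) rested on the single named fact #60 `SiegelS1`
(Shimura's canonical model of the Siegel tower with integral Hecke operators).  This file replaces that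
fact by the reciprocity-free, print-shaped fact M1′ `deligne1971_siegelModuliOnPoints` — Mumford's
moduli scheme is a `ℚ`-model of the Siegel modular variety whose map `M_K → M_K(ℂ)` commutes with
`Aut(ℂ)` ([Deligne 1971] 4.16–4.21, [Mumford–Fogarty–Kirwan] Thm. 7.9 + App. 7A, [Milne ISV] §14) — and
DERIVES `SiegelS1` from it: Shimura reciprocity at CM points ([Milne ISV] Prop. 14.12) is the hypothesis-free
theorem `MumfordRouteXi.cmConjugationIsogenyAll_holds` (main theorem of complex multiplication in isogeny
form over the whole CM algebra, the completed lattice sandwich, the adelic markings of T1′), composed by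
the receptacle head `MumfordModuli.siegelS1_of_cmConjugationIsogenyAll`.

Main results (namespace `Summit.HodgeConjecture.HodgeConjecture.Theorems`):
* `siegelS1_of_mumford : deligne1971_siegelModuliOnPoints → SiegelS1`;
* `HDel_of_mumford : deligne1971_siegelModuliOnPoints → Summit.HodgeConjecture.HodgeConjecture.Theses.HCCMUnconditional.HDel`.

Certified beforehand by paste on the same tree: `A-provers/A-p05/HDelOfMumford.e2e.byimport.A-p05g7.lean`
cd71bd19 (REF1 pre-cert PASS, ref3 K50 reproduction + planted-defect controls).  HC_CM is proved only
modulo the printed citations until rung 0 closes; this file moves the `hDel` binder from citation #60 to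
citation M1′ and proves nothing about M1′ itself.

## References
* [Deligne1971TravauxShimura] P. Deligne, *Travaux de Shimura*, Sém. Bourbaki 389 (1971), 4.16–4.17 p. 150, Thm. 4.21 p. 152.
* [MumfordFogartyKirwan1994] D. Mumford, J. Fogarty, F. Kirwan, *Geometric Invariant Theory*, 3rd ed., Thm. 7.9, App. 7A.
* [Milne2005ShimuraVarieties] J. S. Milne, *Introduction to Shimura varieties*, §14 Prop. 14.12 p. 125; Thm. 6.11 p. 74.
* [Shimura1998] G. Shimura, *Abelian Varieties with Complex Multiplication and Modular Functions*, Thm. 18.6 p. 127.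
-/

-- The summit and its single sub-problem are both named `HodgeConjecture` (D-0017 nested layout).
set_option linter.dupNamespace false

namespace Summit.HodgeConjecture.HodgeConjecture.Theorems

open Literature.AlgebraicGeometry.ModuliOfAbelianVarieties
open Summit.HodgeConjecture.CorCM.HypDel

/-- **#60 `SiegelS1` from M1′ alone**: Mumford's moduli model on points (`deligne1971_siegelModuliOnPoints`)
yields Shimura's canonical model of the Siegel tower with integral Hecke operators — the reciprocity law at CM
points is the theorem `MumfordRouteXi.cmConjugationIsogenyAll_holds`, fed to the receptacle head
`MumfordModuli.siegelS1_of_cmConjugationIsogenyAll` ([Milne ISV] Prop. 14.12 «if this map commutes with the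
actions of `Aut(ℂ)`, then `M_K` is canonical»).
[cite: Milne2005ShimuraVarieties, §14 Prop. 14.12 p. 125] [cite: Deligne1971TravauxShimura, Thm. 4.21 p. 152] -/
theorem siegelS1_of_mumford (hM : deligne1971_siegelModuliOnPoints) : SiegelS1 :=
  MumfordModuli.siegelS1_of_cmConjugationIsogenyAll hM MumfordRouteXi.cmConjugationIsogenyAll_holds

/-- **The crux `HDel` of route `HCCMUnconditional` from M1′ alone** (via ★ `HDel_of_S1`: after #61
`siegel_borel_extension_holds` the crux needs only `SiegelS1`, which `siegelS1_of_mumford` supplies).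
[cite: Deligne1971TravauxShimura, 4.16–4.17 p. 150; Thm. 4.21 p. 152] [cite: MumfordFogartyKirwan1994, Thm. 7.9 and App. 7A] -/
theorem HDel_of_mumford (hM : deligne1971_siegelModuliOnPoints) :
    Summit.HodgeConjecture.HodgeConjecture.Theses.HCCMUnconditional.HDel :=
  HDel_of_S1 (siegelS1_of_mumford hM)

end Summit.HodgeConjecture.HodgeConjecture.Theorems
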